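import Summits.QuantumFields.QCD.Theses.PauliWegnerSea
import Literature.MathematicalPhysics.QuantumLattice.OverlapLocality
import Literature.MathematicalPhysics.QuantumLattice.WilsonPropagatorHeavyMass
import Literature.MathematicalPhysics.QuantumLattice.GrassmannIntegralWilsonProofs
import Literature.MathematicalPhysics.QuantumLattice.GaugeGroups

/-!
# Stub `stub_maximiser` of crux `FibreCofactorDomination` (stmt-QuantumFields-11510)

Line `Sketch-ideator3` (card A `random-refit-second-moment`), route PauliWegnerSea (sub QCD).

First-moment maximiser: some configuration W′ has |det D_W(refit W′)|² at least the product-Haar mean of W ↦ |det D_W(refit W)|².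
-/

noncomputable section

namespace Summit.QuantumFields.QCD.Theorems.RandomRefit

open scoped BigOperators Matrix
open MeasureTheory Filter Literature.MathematicalPhysics.QuantumFieldTheory
  Literature.MathematicalPhysics.QuantumLattice Literature.Probability.LatticeModels

/-- First-moment maximiser on the fibre: there is `W′` with `∫ |det D_W(refit W)|² dHaar(W) ≤ |det D_W(refit W′)|²` (probability measure; if the integrand were not integrable the integral is `0`). -/
theorem stub_maximiser : ∀ (m₀ : ℝ) (L : ℕ) [NeZero L]
    (U : GaugeConfig 4 L (Matrix.specialUnitaryGroup (Fin 3) ℂ)) (x y : TorusSite 4 L),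
    ∃ W' : GaugeConfig 4 L (Matrix.specialUnitaryGroup (Fin 3) ℂ),
      ∫ W, ‖(wilsonDirac (fundamentalRep (Fin 3)) (fun e => if e.1 = x ∨ Site.shift e.1 e.2 = x ∨ e.1 = y ∨ Site.shift e.1 e.2 = y then W e else U e) m₀ 1).det‖ ^ 2
          ∂(Measure.pi fun _ : Edge 4 L => haarProbability (Matrix.specialUnitaryGroup (Fin 3) ℂ)) ≤
        ‖(wilsonDirac (fundamentalRep (Fin 3)) (fun e => if e.1 = x ∨ Site.shift e.1 e.2 = x ∨ e.1 = y ∨ Site.shift e.1 e.2 = y then W' e else U e) m₀ 1).det‖ ^ 2 := by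
  intro m₀ L _ U x y
  by_cases hf : Integrable (fun W : GaugeConfig 4 L (Matrix.specialUnitaryGroup (Fin 3) ℂ) =>
      ‖(wilsonDirac (fundamentalRep (Fin 3)) (fun e => if e.1 = x ∨ Site.shift e.1 e.2 = x ∨
        e.1 = y ∨ Site.shift e.1 e.2 = y then W e else U e) m₀ 1).det‖ ^ 2)
      (Measure.pi fun _ : Edge 4 L => haarProbability (Matrix.specialUnitaryGroup (Fin 3) ℂ))
  · obtain ⟨W', hW'⟩ := exists_integral_le hf
    exact ⟨W', hW'⟩
  · refine ⟨fun _ => 1, ?_⟩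
    rw [integral_undef hf]
    positivity

end Summit.QuantumFields.QCD.Theorems.RandomRefit

end
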